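import Summits.MatrixMultiplication.MatrixMultiplication.Theorems.SaturationLadderTwinCeilingCore
import HarnessLib

/-!
# SaturationLadder — Kernel XXVIII (i): the SHARP BAND of the twin pencil — second-order entropy cores

Support for the deciding crux `SubexpSaturation` (h₁, item 25909) of `Theses/SaturationLadder.lean`
(cell `decomp-mm`, lens «grading / quantitative ladder», gen 56).  No definitions, no named facts,
no `sorry`.  First file of the move `…CornerBandCore → …CornerBand → …CornerFamily` (the CORNER
FAMILY of twin types, whose defects tend to the twin-class ceiling `c₂ = (5 log 5 − 7 log 2)/3`).

THE PENCIL (`Theorems/SaturationLadderTwinCeilingCore|Pencil|….lean`, gen 14): for `κ = p/q ∈ [0,1]`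
the twin type with letter counts `n₁ = 3qj+2q`, `n₃ = n₁ + 2p`, `n₂ = 2qj·2^{j+1} − n₃`, `n₄ = qj − 2q`,
`n₅ = 0`, `n₆ = 2qj` is output-perfect, and the two entropy hypotheses of the exact six-type theorem
`omegaRect_one_tw_exact` read, in units of `1/d` (`d = B + 3`, `B = 2^{j+1}`, `ε = 1/j`),
`H(Z) ≤ H(Y)`, `H(Z) ≤ H(X)` for `Z = (2, B, 1)`, `Y = (α, d − τ, γ)`, `X = (d − σ, σ, 0)`,
`α = 5/2 + (1+κ)ε`, `γ = 1/2 − ε`, `τ = 3 + κε`, `σ = 3 + (2+κ)ε`.  Exactly (`g(x) := −(d−x) log(1−x/d)`),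

  `d·(H(Y) − H(Z)) = (τ − 3) log d − α log α − γ log γ + 2 log 2 + g(τ) − g(3)`
  `             = δ(κ) − c₁(κ)·ε − (1 + (1+κ)²/5)·ε² + O(ε³)`,
  `δ(κ) := (5/2 + κ) log 2 − (5/2) log(5/2)`,  `c₁(κ) := (1+κ) log(5/2) + (1−κ) log 2 = log 5 + κ log(5/4)`.

The gen-14 cores `coreY`/`coreX` used FIRST-order logarithm bounds and asked `ε ≤ 1/1000`,
`30 ε ≤ δ(κ)`; `Theorems/SaturationLadderTwinFamilyY64.lean` sharpened the constants for the single
member `κ = 17/20` down to `j ≥ 64`.  THIS FILE proves both inequalities on the SHARP BAND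

  `hA :  c₁(κ)·ε + 2ε² ≤ δ(κ)`,   `0 ≤ κ ≤ 1`,   `ε ≤ 1/16`,   `2 ≤ ε⁴ B`,

using THIRD-order Taylor bounds (`log_one_add_le_taylor`, `log_one_sub_le_taylor`, from
`Real.abs_log_sub_add_sum_range_le`): `bandCoreY` (budget `d·ΔH ≥ 0.2ε² − (2/3)ε³ − 25.8ε⁴ > 0`) and
`bandCoreX` (budget `≥ 0.014 + 0.37ε − 1.05ε²`).  The band is asymptotically EXACT: its boundary
`κ_A(j)` satisfies `j·δ(κ_A(j)) → log 5 + κ₀ log(5/4) = 1.78903…` (`κ₀ = 0.80482…` the zero of `δ`),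
the true `Y`-threshold of the pencil (numerics `gen56/num/band_verify.py`: at `j = 3000` the true
margin left at the band boundary is `4·10⁻⁸` nats·d; at `j = 16` it is `7·10⁻⁴`).  Consequences
(next files): every pencil member is an exact value of `ω(1,·,·)` from `j ≥ max(16, j_A(κ))` with
`j_A(κ) ≈ 1.8/δ(κ)` instead of `max(1000, 30/δ(κ))`, and the moving member `p_j = ⌈10κ₀ j⌉ + 29`,
`q_j = 10j` (the CORNER FAMILY) is exact for every `j ≥ 16` with defect `→ c₂`.

References: D. Coppersmith, S. Winograd, J. Symbolic Comput. 9 (1990) §8 (key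
`CoppersmithWinograd1990`); J. Alman, R. Duan, V. Vassilevska Williams, Y. Xu, Z. Xu, R. Zhou, SODA
2025, §3.4 (key `AlmanDuanVassilevskaWilliamsXuXuZhou2025`).
-/

set_option linter.dupNamespace false
-- (single-conjunct summit: the namespace repeats `MatrixMultiplication`)

noncomputable section

namespace Summit.MatrixMultiplication.MatrixMultiplication.Theorems.SaturationLadderCornerBandCore

open Summit.MatrixMultiplication.MatrixMultiplication.Theorems.SaturationLadderTwinFamilyX
  (log_three_le)
open Summit.MatrixMultiplication.MatrixMultiplication.Theorems.SaturationLadderTwinCeilingCore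
  (le_log_five_halves thresholdX_sub_thresholdY zSide_le sub_sq_le_negMulLog_one_sub)

/-! ## Third-order logarithm bounds -/

/-- `log(1 + y) ≤ y − y²/2 + y³/3 + (20/19) y⁴` for `0 ≤ y ≤ 1/20` (three Taylor terms, remainder
`y⁴/(1−y)`). [folklore] -/
theorem log_one_add_le_taylor {y : ℝ} (hy0 : 0 ≤ y) (hy : y ≤ 1 / 20) :
    Real.log (1 + y) ≤ y - y ^ 2 / 2 + y ^ 3 / 3 + 20 / 19 * y ^ 4 := by
  have hlt : |(-y)| < 1 := by rw [abs_neg, abs_of_nonneg hy0]; linarith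
  have h := Real.abs_log_sub_add_sum_range_le hlt 3
  rw [abs_le] at h
  have h2 := h.2
  simp only [Finset.sum_range_succ, Finset.sum_range_zero] at h2
  norm_num at h2
  rw [abs_of_nonneg hy0] at h2
  have hrem : y ^ 4 / (1 - y) ≤ 20 / 19 * y ^ 4 := by
    rw [div_le_iff₀ (by linarith)]
    have h4 : 0 ≤ y ^ 4 := by positivity
    nlinarith
  have e1 : (-y) ^ 3 = -(y ^ 3) := by ring
  rw [e1] at h2
  linarith

/-- `log(1 − x) ≤ −x − x²/2 − x³/3 + (8/7) x⁴` for `0 ≤ x ≤ 1/8` (three Taylor terms, remainder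
`x⁴/(1−x)`). [folklore] -/
theorem log_one_sub_le_taylor {x : ℝ} (hx0 : 0 ≤ x) (hx : x ≤ 1 / 8) :
    Real.log (1 - x) ≤ -x - x ^ 2 / 2 - x ^ 3 / 3 + 8 / 7 * x ^ 4 := by
  have hlt : |x| < 1 := by rw [abs_of_nonneg hx0]; linarith
  have h := Real.abs_log_sub_add_sum_range_le hlt 3
  rw [abs_le] at h
  have h2 := h.2
  simp only [Finset.sum_range_succ, Finset.sum_range_zero] at h2
  norm_num at h2
  rw [abs_of_nonneg hx0] at h2
  have hrem : x ^ 4 / (1 - x) ≤ 8 / 7 * x ^ 4 := by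
    rw [div_le_iff₀ (by linarith)]
    have h4 : 0 ≤ x ^ 4 := by positivity
    nlinarith
  linarith

/-! ## The two entropy inequalities on the sharp band

Parameters: `κ ∈ [0,1]`, `ε = 1/j ≤ 1/16` with the BAND CONDITION `c₁(κ) ε + 2 ε² ≤ δ(κ)`,
`B = 2^{j+1}` (only `log B = (j+1) log 2` and `2 ≤ ε⁴ B`, i.e. `j⁴ ≤ 2^j`, are used), `d = B + 3`;
laws `Z = (2, B, 1)/d`, `Y = (α, d − τ, γ)/d`, `X = (d − σ, σ, 0)/d` as above (nats, `0 log 0` dropped). -/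

set_option maxHeartbeats 800000 in
-- (one `linarith` over ~20 hypotheses with products of `κ, ε, log 2, log(5/2)`; kept as in `coreY`)
/-- **Sharp `Y`-core: `H(Z) ≤ H(Y)` on the band** `c₁(κ)ε + 2ε² ≤ δ(κ)`, `κ ∈ [0,1]`, `ε ≤ 1/16`,
`2 ≤ ε⁴B`. [cite: CoppersmithWinograd1990, §8] [cite: AlmanDuanVassilevskaWilliamsXuXuZhou2025, §3.4] -/
theorem bandCoreY (κ ε j B d α γ τ : ℝ) (hκ0 : 0 ≤ κ) (hκ1 : κ ≤ 1) (hε0 : 0 < ε)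
    (hεle : ε ≤ 1 / 16) (hεJ : ε * j = 1)
    (hA : ((1 + κ) * Real.log (5 / 2) + (1 - κ) * Real.log 2) * ε + 2 * ε ^ 2 ≤
      (5 / 2 + κ) * Real.log 2 - 5 / 2 * Real.log (5 / 2))
    (hB4 : 2 ≤ ε ^ 4 * B) (hlogB : Real.log B = (j + 1) * Real.log 2)
    (hd : d = B + 3) (hα : α = 5 / 2 + (1 + κ) * ε) (hγ : γ = 1 / 2 - ε) (hτ : τ = 3 + κ * ε) :
    Real.negMulLog (2 / d) + Real.negMulLog (B / d) + Real.negMulLog (1 / d) ≤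
      Real.negMulLog (α / d) + Real.negMulLog (1 - τ / d) + Real.negMulLog (γ / d) := by
  -- sizes
  have hε4 : 0 < ε ^ 4 := by positivity
  have hε4le : ε ^ 4 ≤ (1 / 16) ^ 4 := pow_le_pow_left₀ hε0.le hεle 4
  have hBpos : 0 < B := by
    by_contra h
    nlinarith [hB4, hε4.le, not_lt.mp h]
  have hB131 : (131072 : ℝ) ≤ B := by nlinarith [hε4le, hB4, hBpos.le]
  have hB1 : 1 / B ≤ ε ^ 4 / 2 := by
    rw [div_le_div_iff₀ hBpos two_pos]; linarith
  have hdpos : 0 < d := by rw [hd]; linarith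
  have hBd : B ≤ d := by rw [hd]; linarith
  have hjε : j = 1 / ε := by rw [eq_div_iff hε0.ne']; linarith only [hεJ]
  have hjpos : 0 < j := by rw [hjε]; positivity
  have hh0 : 0 ≤ (1 + κ) * ε := by positivity
  have hh2ε : (1 + κ) * ε ≤ 2 * ε := by nlinarith [hκ1, hε0.le]
  have hαpos : 0 < α := by rw [hα]; positivity
  have hα' : α ≤ 21 / 8 := by rw [hα]; linarith only [hh2ε, hεle]
  have hγpos : 0 < γ := by rw [hγ]; linarith only [hεle]
  have hγle : γ ≤ 1 / 2 := by rw [hγ]; linarith only [hε0]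
  have hκε : 0 ≤ κ * ε := by positivity
  have hκε' : κ * ε ≤ 1 / 16 :=
    calc κ * ε ≤ 1 * ε := mul_le_mul_of_nonneg_right hκ1 hε0.le
      _ ≤ 1 / 16 := by rw [one_mul]; exact hεle
  have hτ3 : 3 ≤ τ := by rw [hτ]; linarith only [hκε]
  have hτ4 : τ ≤ 4 := by rw [hτ]; linarith only [hκε']
  have hτd : τ / d < 1 := by
    rw [div_lt_one hdpos]; linarith only [hB131, hBd, hτ4]
  -- (Z) upper bound
  have hZle := zSide_le j B d hBpos hd hlogB
  -- (Y) the three terms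
  have hY0 : Real.negMulLog (α / d) = α / d * (Real.log d - Real.log α) := by
    simp only [Real.negMulLog, Real.log_div hαpos.ne' hdpos.ne']; ring
  have hY2 : Real.negMulLog (γ / d) = γ / d * (Real.log d - Real.log γ) := by
    simp only [Real.negMulLog, Real.log_div hγpos.ne' hdpos.ne']; ring
  have hY1 : τ / d - (τ / d) ^ 2 ≤ Real.negMulLog (1 - τ / d) := sub_sq_le_negMulLog_one_sub hτd
  -- logarithm bounds
  have hlogd : (j + 1) * Real.log 2 ≤ Real.log d := by
    have : Real.log B ≤ Real.log d := Real.log_le_log hBpos hBd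
    rw [hlogB] at this; exact this
  have hy0 : 0 ≤ 2 / 5 * ((1 + κ) * ε) := by positivity
  have hy1 : 2 / 5 * ((1 + κ) * ε) ≤ 1 / 20 := by linarith only [hh2ε, hεle]
  have hlogα : Real.log α ≤ Real.log (5 / 2) + (2 / 5 * ((1 + κ) * ε) -
      (2 / 5 * ((1 + κ) * ε)) ^ 2 / 2 + (2 / 5 * ((1 + κ) * ε)) ^ 3 / 3 +
      20 / 19 * (2 / 5 * ((1 + κ) * ε)) ^ 4) := by
    have e : α = 5 / 2 * (1 + 2 / 5 * ((1 + κ) * ε)) := by rw [hα]; ring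
    have hpos : (0 : ℝ) < 1 + 2 / 5 * ((1 + κ) * ε) := by positivity
    rw [e, Real.log_mul (by norm_num) hpos.ne']
    have := log_one_add_le_taylor hy0 hy1
    linarith
  have hlogγ : Real.log γ ≤ -Real.log 2 + (-(2 * ε) - (2 * ε) ^ 2 / 2 - (2 * ε) ^ 3 / 3 +
      8 / 7 * (2 * ε) ^ 4) := by
    have e : γ = 1 / 2 * (1 - 2 * ε) := by rw [hγ]; ring
    have hpos : (0 : ℝ) < 1 - 2 * ε := by linarith only [hεle]
    rw [e, Real.log_mul (by norm_num) hpos.ne']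
    have h12 : Real.log (1 / 2 : ℝ) = -Real.log 2 := by
      rw [one_div, Real.log_inv]
    have := log_one_sub_le_taylor (x := 2 * ε) (by positivity) (by linarith only [hεle])
    linarith
  have hl2 := Real.log_two_gt_d9
  have hl2' := Real.log_two_lt_d9
  have hP := le_log_five_halves
  -- the key scaled inequality
  have key : 3 / B + ((3 * j + 1) * Real.log 2) / d ≤
      α / d * (Real.log d - Real.log α) + (τ / d - (τ / d) ^ 2) +
        γ / d * (Real.log d - Real.log γ) := by
    have hAl : α * ((j + 1) * Real.log 2 - (Real.log (5 / 2) + (2 / 5 * ((1 + κ) * ε) -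
        (2 / 5 * ((1 + κ) * ε)) ^ 2 / 2 + (2 / 5 * ((1 + κ) * ε)) ^ 3 / 3 +
        20 / 19 * (2 / 5 * ((1 + κ) * ε)) ^ 4))) ≤ α * (Real.log d - Real.log α) :=
      mul_le_mul_of_nonneg_left (by linarith) hαpos.le
    have hGl : γ * ((j + 1) * Real.log 2 - (-Real.log 2 + (-(2 * ε) - (2 * ε) ^ 2 / 2 -
        (2 * ε) ^ 3 / 3 + 8 / 7 * (2 * ε) ^ 4))) ≤ γ * (Real.log d - Real.log γ) :=
      mul_le_mul_of_nonneg_left (by linarith) hγpos.le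
    -- expand `(α + γ)(j+1) log 2`, using `ε j = 1`, and substitute `α, γ` elsewhere
    have hexp : α * ((j + 1) * Real.log 2 - (Real.log (5 / 2) + (2 / 5 * ((1 + κ) * ε) -
        (2 / 5 * ((1 + κ) * ε)) ^ 2 / 2 + (2 / 5 * ((1 + κ) * ε)) ^ 3 / 3 +
        20 / 19 * (2 / 5 * ((1 + κ) * ε)) ^ 4))) +
        γ * ((j + 1) * Real.log 2 - (-Real.log 2 + (-(2 * ε) - (2 * ε) ^ 2 / 2 -
        (2 * ε) ^ 3 / 3 + 8 / 7 * (2 * ε) ^ 4))) =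
        3 * j * Real.log 2 + (3 + κ) * Real.log 2 + κ * ε * Real.log 2 -
          (5 / 2 + (1 + κ) * ε) * (Real.log (5 / 2) + (2 / 5 * ((1 + κ) * ε) -
            (2 / 5 * ((1 + κ) * ε)) ^ 2 / 2 + (2 / 5 * ((1 + κ) * ε)) ^ 3 / 3 +
            20 / 19 * (2 / 5 * ((1 + κ) * ε)) ^ 4)) -
          (1 / 2 - ε) * (-Real.log 2 + (-(2 * ε) - (2 * ε) ^ 2 / 2 - (2 * ε) ^ 3 / 3 +
            8 / 7 * (2 * ε) ^ 4)) := by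
      rw [hα, hγ]
      linear_combination (κ * Real.log 2) * hεJ
    -- bounds on the small terms
    have hb1 : 9 / B ≤ 9 / 2 * ε ^ 4 := by
      have : 9 / B = 9 * (1 / B) := by ring
      rw [this]; linarith only [hB1]
    have hτ2 : τ ^ 2 ≤ 16 := by
      have h := mul_le_mul hτ4 hτ4 (by linarith only [hτ3]) (by norm_num)
      rw [sq]; linarith only [h]
    have hb2 : τ ^ 2 / d ≤ 8 * ε ^ 4 := by
      calc τ ^ 2 / d ≤ 16 / d := div_le_div_of_nonneg_right hτ2 hdpos.le
        _ ≤ 16 / B := div_le_div_of_nonneg_left (by norm_num) hBpos hBd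
        _ = 16 * (1 / B) := by ring
        _ ≤ 8 * ε ^ 4 := by linarith only [hB1]
    have hy4 : (2 / 5 * ((1 + κ) * ε)) ^ 4 ≤ (4 / 5 * ε) ^ 4 :=
      pow_le_pow_left₀ hy0 (by linarith only [hh2ε]) 4
    have hJ1 : (5 / 2 + (1 + κ) * ε) * (20 / 19 * (2 / 5 * ((1 + κ) * ε)) ^ 4) ≤
        21 / 8 * (20 / 19 * (256 / 625 * ε ^ 4)) := by
      have e4 : (4 / 5 * ε) ^ 4 = 256 / 625 * ε ^ 4 := by ring
      rw [← hα]
      refine mul_le_mul hα' ?_ (by positivity) (by norm_num)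
      rw [← e4]
      exact mul_le_mul_of_nonneg_left hy4 (by norm_num)
    have hJ2 : (1 / 2 - ε) * (8 / 7 * (2 * ε) ^ 4) ≤ 1 / 2 * (8 / 7 * (16 * ε ^ 4)) := by
      have e4 : (2 * ε) ^ 4 = 16 * ε ^ 4 := by ring
      rw [e4, ← hγ]
      exact mul_le_mul_of_nonneg_right hγle (by positivity)
    have hh2 : ((1 + κ) * ε) ^ 2 ≤ (2 * ε) ^ 2 := pow_le_pow_left₀ hh0 hh2ε 2
    have hh3 : 0 ≤ ((1 + κ) * ε) ^ 3 := by positivity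
    have hh4 : ((1 + κ) * ε) ^ 4 ≤ (2 * ε) ^ 4 := pow_le_pow_left₀ hh0 hh2ε 4
    have hε2 : ε ^ 2 ≤ (1 / 16) ^ 2 := pow_le_pow_left₀ hε0.le hεle 2
    have hε3 : ε ^ 3 ≤ ε ^ 2 / 16 := by
      have h := mul_le_mul_of_nonneg_left hεle (sq_nonneg ε)
      calc ε ^ 3 = ε ^ 2 * ε := by ring
        _ ≤ ε ^ 2 * (1 / 16) := h
        _ = ε ^ 2 / 16 := by ring
    have hε4' : ε ^ 4 ≤ ε ^ 2 / 256 := by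
      have h := mul_le_mul_of_nonneg_left hε2 (sq_nonneg ε)
      calc ε ^ 4 = ε ^ 2 * ε ^ 2 := by ring
        _ ≤ ε ^ 2 * (1 / 16) ^ 2 := h
        _ = ε ^ 2 / 256 := by ring
    have hεsq : 0 < ε ^ 2 := by positivity
    have h3dB : 3 * d / B = 3 + 9 / B := by
      rw [hd]; field_simp; ring
    -- the goal multiplied by `d`
    have hscaled : 3 * d / B + (3 * j + 1) * Real.log 2 ≤
        α * (Real.log d - Real.log α) + τ - τ ^ 2 / d + γ * (Real.log d - Real.log γ) := by
      rw [h3dB]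
      linarith only [hAl, hGl, hexp, hb1, hb2, hJ1, hJ2, hh2, hh3, hh4, hε3, hε4', hεsq, hA, hτ,
        hε0.le, hκ0, hκ1, hl2, hl2', hP]
    have hdiv := div_le_div_of_nonneg_right hscaled hdpos.le
    have e1 : 3 / B + ((3 * j + 1) * Real.log 2) / d =
        (3 * d / B + (3 * j + 1) * Real.log 2) / d := by
      field_simp
    have e2 : α / d * (Real.log d - Real.log α) + (τ / d - (τ / d) ^ 2) +
        γ / d * (Real.log d - Real.log γ) =
        (α * (Real.log d - Real.log α) + τ - τ ^ 2 / d + γ * (Real.log d - Real.log γ)) / d := by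
      field_simp; ring
    rw [e1, e2]; exact hdiv
  linarith only [hZle, hY0, hY1, hY2, key]

set_option maxHeartbeats 800000 in
-- (as above)
/-- **Sharp `X`-core: `H(Z) ≤ H(X)` on the band** (same regime; the `X`-threshold `3 log₂ 3 − 4 =
0.7549…` lies `0.05` below the band, so first-order bounds suffice here).
[cite: CoppersmithWinograd1990, §8] [cite: AlmanDuanVassilevskaWilliamsXuXuZhou2025, §3.4] -/
theorem bandCoreX (κ ε j B d σ : ℝ) (hκ0 : 0 ≤ κ) (hκ1 : κ ≤ 1) (hε0 : 0 < ε)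
    (hεle : ε ≤ 1 / 16) (hεJ : ε * j = 1)
    (hA : ((1 + κ) * Real.log (5 / 2) + (1 - κ) * Real.log 2) * ε + 2 * ε ^ 2 ≤
      (5 / 2 + κ) * Real.log 2 - 5 / 2 * Real.log (5 / 2))
    (hB4 : 2 ≤ ε ^ 4 * B) (hlogB : Real.log B = (j + 1) * Real.log 2)
    (hd : d = B + 3) (hσ : σ = 3 + (2 + κ) * ε) :
    Real.negMulLog (2 / d) + Real.negMulLog (B / d) + Real.negMulLog (1 / d) ≤
      Real.negMulLog (1 - σ / d) + Real.negMulLog (σ / d) := by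
  -- sizes
  have hε4 : 0 < ε ^ 4 := by positivity
  have hε4le : ε ^ 4 ≤ (1 / 16) ^ 4 := pow_le_pow_left₀ hε0.le hεle 4
  have hBpos : 0 < B := by
    by_contra h
    nlinarith [hB4, hε4.le, not_lt.mp h]
  have hB131 : (131072 : ℝ) ≤ B := by nlinarith [hε4le, hB4, hBpos.le]
  have hB1 : 1 / B ≤ ε ^ 4 / 2 := by
    rw [div_le_div_iff₀ hBpos two_pos]; linarith
  have hdpos : 0 < d := by rw [hd]; linarith
  have hBd : B ≤ d := by rw [hd]; linarith
  have hjε : j = 1 / ε := by rw [eq_div_iff hε0.ne']; linarith only [hεJ]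
  have hjpos : 0 < j := by rw [hjε]; positivity
  have hs0 : 0 ≤ σ - 3 := by
    have h : 0 ≤ (2 + κ) * ε := by positivity
    rw [hσ]; linarith only [h]
  have hs3 : σ - 3 ≤ 3 * ε := by
    have h := mul_le_mul_of_nonneg_right (show 2 + κ ≤ 3 by linarith only [hκ1]) hε0.le
    rw [hσ]; linarith only [h]
  have hσpos : 0 < σ := by linarith only [hs0]
  have hσ4 : σ ≤ 4 := by linarith only [hs3, hεle]
  have hσd : σ / d < 1 := by
    rw [div_lt_one hdpos]; linarith only [hB131, hBd, hσ4]
  -- (Z) upper bound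
  have hZle := zSide_le j B d hBpos hd hlogB
  -- (X) the two terms
  have hX1 : Real.negMulLog (σ / d) = σ / d * (Real.log d - Real.log σ) := by
    simp only [Real.negMulLog, Real.log_div hσpos.ne' hdpos.ne']; ring
  have hX0 : σ / d - (σ / d) ^ 2 ≤ Real.negMulLog (1 - σ / d) := sub_sq_le_negMulLog_one_sub hσd
  -- logarithm bounds
  have hlogd : (j + 1) * Real.log 2 ≤ Real.log d := by
    have : Real.log B ≤ Real.log d := Real.log_le_log hBpos hBd
    rw [hlogB] at this; exact this
  have hlogσ : Real.log σ ≤ Real.log 3 + (σ - 3) / 3 := by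
    have h := Real.log_le_sub_one_of_pos (show 0 < σ / 3 by positivity)
    rw [Real.log_div hσpos.ne' three_ne_zero] at h
    linarith
  have hl2 := Real.log_two_gt_d9
  have hl2' := Real.log_two_lt_d9
  have hl3 := log_three_le
  have hP := le_log_five_halves
  have h23 : Real.log 2 ≤ Real.log 3 := Real.log_le_log two_pos (by norm_num)
  have hP2 : Real.log 2 ≤ Real.log (5 / 2) := Real.log_le_log two_pos (by norm_num)
  have hXY := thresholdX_sub_thresholdY
  -- the band condition implies `(log(5/2) + log 2) ε + 2 ε² ≤ δ(κ)`
  have hc1 : (Real.log (5 / 2) + Real.log 2) * ε ≤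
      ((1 + κ) * Real.log (5 / 2) + (1 - κ) * Real.log 2) * ε := by
    apply mul_le_mul_of_nonneg_right _ hε0.le
    nlinarith [mul_nonneg hκ0 (sub_nonneg.2 hP2)]
  -- `(σ − 3) j = 2 + κ`
  have hσJ : (σ - 3) * j = 2 + κ := by rw [hσ]; linear_combination (2 + κ) * hεJ
  -- the key scaled inequality
  have key : 3 / B + ((3 * j + 1) * Real.log 2) / d ≤
      σ / d * (Real.log d - Real.log σ) + (σ / d - (σ / d) ^ 2) := by
    have hAl : σ * ((j + 1) * Real.log 2 - Real.log 3 - (σ - 3) / 3) ≤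
        σ * (Real.log d - Real.log σ) := mul_le_mul_of_nonneg_left (by linarith) hσpos.le
    have hexp : σ * ((j + 1) * Real.log 2 - Real.log 3 - (σ - 3) / 3) =
        3 * (j + 1) * Real.log 2 + (2 + κ) * Real.log 2 + (σ - 3) * Real.log 2 -
          σ * Real.log 3 - (σ - 3) - (σ - 3) ^ 2 / 3 := by
      linear_combination Real.log 2 * hσJ
    -- bounds on the small terms
    have hb1 : 9 / B ≤ 9 / 2 * ε ^ 4 := by
      have : 9 / B = 9 * (1 / B) := by ring
      rw [this]; linarith only [hB1]
    have hσ2 : σ ^ 2 ≤ 16 := by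
      have h := mul_le_mul hσ4 hσ4 hσpos.le (by norm_num)
      rw [sq]; linarith only [h]
    have hb2 : σ ^ 2 / d ≤ 8 * ε ^ 4 := by
      calc σ ^ 2 / d ≤ 16 / d := div_le_div_of_nonneg_right hσ2 hdpos.le
        _ ≤ 16 / B := div_le_div_of_nonneg_left (by norm_num) hBpos hBd
        _ = 16 * (1 / B) := by ring
        _ ≤ 8 * ε ^ 4 := by linarith only [hB1]
    have hb3 : (σ - 3) * (Real.log 3 - Real.log 2) ≤ 3 * ε * 0.412 :=
      mul_le_mul hs3 (by linarith only [hl3, hl2]) (by linarith only [h23]) (by positivity)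
    have hb4 : (σ - 3) ^ 2 / 3 ≤ 3 * ε ^ 2 := by
      have h : (σ - 3) ^ 2 ≤ (3 * ε) ^ 2 := pow_le_pow_left₀ hs0 hs3 2
      have e : (3 * ε) ^ 2 = 9 * ε ^ 2 := by ring
      rw [e] at h; linarith only [h]
    have hε2 : ε ^ 2 ≤ (1 / 16) ^ 2 := pow_le_pow_left₀ hε0.le hεle 2
    have hb5 : ε ^ 2 ≤ ε / 16 := by
      have h := mul_le_mul_of_nonneg_left hεle hε0.le
      calc ε ^ 2 = ε * ε := sq ε
        _ ≤ ε * (1 / 16) := h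
        _ = ε / 16 := by ring
    have hε4' : ε ^ 4 ≤ ε ^ 2 / 256 := by
      have h := mul_le_mul_of_nonneg_left hε2 (sq_nonneg ε)
      calc ε ^ 4 = ε ^ 2 * ε ^ 2 := by ring
        _ ≤ ε ^ 2 * (1 / 16) ^ 2 := h
        _ = ε ^ 2 / 256 := by ring
    have hPε : 0.9158 * ε ≤ Real.log (5 / 2) * ε := mul_le_mul_of_nonneg_right hP hε0.le
    have hLε : 0.6931471803 * ε ≤ Real.log 2 * ε := mul_le_mul_of_nonneg_right hl2.le hε0.le
    have h3dB : 3 * d / B = 3 + 9 / B := by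
      rw [hd]; field_simp; ring
    have hscaled : 3 * d / B + (3 * j + 1) * Real.log 2 ≤
        σ * (Real.log d - Real.log σ) + σ - σ ^ 2 / d := by
      rw [h3dB]
      linarith only [hAl, hexp, hb1, hb2, hb3, hb4, hb5, hε4', hA, hc1, hXY, hε0.le, hPε, hLε]
    have hdiv := div_le_div_of_nonneg_right hscaled hdpos.le
    have e1 : 3 / B + ((3 * j + 1) * Real.log 2) / d =
        (3 * d / B + (3 * j + 1) * Real.log 2) / d := by
      field_simp
    have e2 : σ / d * (Real.log d - Real.log σ) + (σ / d - (σ / d) ^ 2) =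
        (σ * (Real.log d - Real.log σ) + σ - σ ^ 2 / d) / d := by
      field_simp; ring
    rw [e1, e2]; exact hdiv
  linarith only [hZle, hX1, hX0, key]

/-- The band lies above `κ₀`: `c₁(κ)ε + 2ε² ≤ δ(κ)` with `ε > 0` forces `δ(κ) > 0`, i.e.
`(5/2) log(5/2) < (5/2 + κ) log 2` (the hypothesis of `saturationBase_param`). [folklore] -/
theorem delta_pos_of_band {κ ε : ℝ} (hκ0 : 0 ≤ κ) (hκ1 : κ ≤ 1) (hε0 : 0 < ε)
    (hA : ((1 + κ) * Real.log (5 / 2) + (1 - κ) * Real.log 2) * ε + 2 * ε ^ 2 ≤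
      (5 / 2 + κ) * Real.log 2 - 5 / 2 * Real.log (5 / 2)) :
    5 / 2 * Real.log (5 / 2) < (5 / 2 + κ) * Real.log 2 := by
  have hl2 := Real.log_two_gt_d9
  have hP := le_log_five_halves
  have h1 : 0 < ((1 + κ) * Real.log (5 / 2) + (1 - κ) * Real.log 2) * ε := by
    apply mul_pos _ hε0
    have ha : 0 ≤ (1 + κ) * Real.log (5 / 2) := by positivity
    have hb : 0 ≤ (1 - κ) * Real.log 2 := mul_nonneg (by linarith) (by linarith)
    have hc : 0 < (1 + κ) * Real.log (5 / 2) := by positivity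
    linarith
  have h2 : 0 ≤ 2 * ε ^ 2 := by positivity
  linarith

end Summit.MatrixMultiplication.MatrixMultiplication.Theorems.SaturationLadderCornerBandCore
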